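import Literature.AlgebraicGeometry.Frobenioids.CoproductCompletion
import Mathlib.Logic.Equiv.Sum
import HarnessLib

/-!
# Frobenioids I, §0: connected objects of `C^⊥`, `C^⊤` and the equivalences `(C^⊥)⁰ ⥲ C`,
# `(C^⊤)⁰ ⥲ C` (§0 residual of the STEP-0 fragment; abc-iut cell, layer L1)

Mochizuki, *The geometry of Frobenioids I: the general theory*, Kyushu J. Math. **62** (2008)
293–400, §0 "Categories", kurims text p. 16 [cite: MochizukiFrdI2008, §0 p.16]:

> "Moreover, there are natural [up to isomorphism] equivalences of categories `(C^⊥)⁰ ⥲ C`;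
> `(C^⊤)⁰ ⥲ C`; `(D⁰)^⊥ ⥲ D`; `(E⁰)^⊤ ⥲ E` for `D` (respectively, `E`) a category of finitely
> connected type (respectively, category of countably connected type)."

This file: connectedness is invariant under isomorphism; in a full subcategory of
`FormalCoproduct C` stable under restriction of index sets and binary sums and containing the empty
formal coproduct, a connected object has a **singleton** index set (split the index set as
`{i = i₀} ⊔ {i ≠ i₀}`), and conversely one-index objects are connected; consequently the functor
`C → (C^⊥)⁰` (resp. `C → (C^⊤)⁰`), `A ↦ incl A`, is an **equivalence** — the printed
`(C^⊥)⁰ ⥲ C`, `(C^⊤)⁰ ⥲ C` up to the choice of direction. Deliberately NOT here: `(D⁰)^⊥ ⥲ D`,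
`(E⁰)^⊤ ⥲ E` (they use the bijectivity clause of "finitely connected type" for `D`, `E`),
"`C^⊥` is of finitely connected type", "totally epimorphic ⇒ `C^⊥` almost totally epimorphic".
No statement of the paper is strengthened.
-/

namespace Literature.AlgebraicGeometry.Frobenioids

open CategoryTheory Limits

universe w v u v' u'

/-! ### Connectedness is invariant under isomorphism (any category) -/

section IsoInvariance

variable {E : Type u'} [Category.{v'} E]

/-- Nonemptiness (non-initiality) is invariant under isomorphism. [cite: MochizukiFrdI2008, §0 p.15] -/
theorem IsNonemptyObj.of_iso {A A' : E} (h : IsNonemptyObj A) (e : A ≅ A') : IsNonemptyObj A' :=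
  ⟨fun h' => h.false (h'.ofIso e.symm)⟩

/-- Connectedness is invariant under isomorphism. [cite: MochizukiFrdI2008, §0 p.15] -/
theorem IsConnectedObj.of_iso {A A' : E} (h : IsConnectedObj A) (e : A ≅ A') : IsConnectedObj A' := by
  refine ⟨h.1.of_iso e, fun B₁ B₂ ι₁ ι₂ hB₁ hB₂ => ⟨fun hc => ?_⟩⟩
  refine (h.2 B₁ B₂ (ι₁ ≫ e.inv) (ι₂ ≫ e.inv) hB₁ hB₂).false ?_
  exact hc.ofIsoColimit (Cocone.ext e.symm (by rintro ⟨⟨⟩⟩ <;> rfl))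

end IsoInvariance

variable {C : Type u} [Category.{v} C]

namespace CoproductCompletion

variable {P : ObjectProperty (FormalCoproduct.{w} C)}

/-! ### Restriction of a formal coproduct to part of its index set -/

/-- The formal sub-coproduct on the indices satisfying `p`. [cite: MochizukiFrdI2008, §0 p.16] -/
def restrict (X : FormalCoproduct.{w} C) (p : X.I → Prop) : FormalCoproduct.{w} C :=
  ⟨{i // p i}, fun i => X.obj i.1⟩

/-- `X ≅ X|_p ⊔ X|_{¬p}` in `FormalCoproduct C`. [cite: MochizukiFrdI2008, §0 p.16] -/
noncomputable def isoSumRestrict (X : FormalCoproduct.{w} C) (p : X.I → Prop) :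
    X ≅ sum (restrict X p) (restrict X fun i => ¬ p i) := by
  classical
  refine FormalCoproduct.isoOfComponents (Equiv.sumCompl p).symm fun i => eqToIso ?_
  have key : ∀ s : {i // p i} ⊕ {i // ¬ p i},
      (sum (restrict X p) (restrict X fun i => ¬ p i)).obj s = X.obj (Equiv.sumCompl p s) := by
    rintro (j | j) <;> rfl
  rw [key]
  exact congrArg X.obj (Equiv.apply_symm_apply (Equiv.sumCompl p) i).symm

/-- A one-index formal coproduct is isomorphic to `incl` of its unique component.
[cite: MochizukiFrdI2008, §0 p.16] -/
def isoInclOfUnique (X : FormalCoproduct.{w} C) [Unique X.I] :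
    X ≅ (FormalCoproduct.incl C).obj (X.obj default) :=
  FormalCoproduct.isoOfComponents (Equiv.equivPUnit X.I) fun i =>
    eqToIso (congrArg X.obj (Unique.eq_default i))

/-! ### Connected objects are exactly the one-index objects -/

/-- In a full subcategory of `FormalCoproduct C` containing the empty object and stable under
restriction and binary sums, a connected object has at most one index.
[cite: MochizukiFrdI2008, §0 p.16] -/
theorem subsingleton_index_of_isConnectedObj (hE : P empty)
    (hres : ∀ (X : FormalCoproduct.{w} C) (p : X.I → Prop), P X → P (restrict X p))
    (hsum : ∀ X Y : FormalCoproduct.{w} C, P X → P Y → P (sum X Y))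
    {X : P.FullSubcategory} (hX : IsConnectedObj X) : Subsingleton X.obj.I := by
  by_contra h
  haveI : Nontrivial X.obj.I := not_subsingleton_iff_nontrivial.mp h
  obtain ⟨i₀, i₁, hne⟩ := exists_pair_ne X.obj.I
  -- split `X ≅ X|_{= i₀} ⊔ X|_{≠ i₀}` inside the subcategory
  let B₁ : P.FullSubcategory := ⟨restrict X.obj fun i => i = i₀, hres _ _ X.property⟩
  let B₂ : P.FullSubcategory := ⟨restrict X.obj fun i => ¬ i = i₀, hres _ _ X.property⟩
  have hS : P (sum B₁.obj B₂.obj) := hsum _ _ B₁.property B₂.property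
  let S : P.FullSubcategory := ⟨sum B₁.obj B₂.obj, hS⟩
  let e : X ≅ S := P.isoMk (isoSumRestrict X.obj fun i => i = i₀)
  have hB₁ : IsNonemptyObj B₁ :=
    ⟨fun hI => PEmpty.elim ((hI.to ⟨empty, hE⟩).hom.f ⟨i₀, rfl⟩)⟩
  have hB₂ : IsNonemptyObj B₂ :=
    ⟨fun hI => PEmpty.elim ((hI.to ⟨empty, hE⟩).hom.f ⟨i₁, fun h => hne h.symm⟩)⟩
  let ι₁ : B₁ ⟶ X := (ObjectProperty.homMk (sumInl B₁.obj B₂.obj) : B₁ ⟶ S) ≫ e.inv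
  let ι₂ : B₂ ⟶ X := (ObjectProperty.homMk (sumInr B₁.obj B₂.obj) : B₂ ⟶ S) ≫ e.inv
  have hc : IsColimit (BinaryCofan.mk ι₁ ι₂) :=
    (sumIsColimitSub B₁ B₂ hS).ofIsoColimit (Cocone.ext e.symm (by rintro ⟨⟨⟩⟩ <;> rfl))
  exact (hX.2 B₁ B₂ ι₁ ι₂ hB₁ hB₂).false hc

/-- A connected object has nonempty index set. [cite: MochizukiFrdI2008, §0 p.16] -/
theorem nonempty_index_of_isConnectedObj {X : P.FullSubcategory} (hX : IsConnectedObj X) :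
    Nonempty X.obj.I :=
  nonempty_index_of_isNonemptyObj hX.1

/-- Conversely, a one-index object is connected (it is isomorphic to some `incl A`), provided the
subcategory contains the empty object, the `incl A` and the two-point objects.
[cite: MochizukiFrdI2008, §0 p.16] -/
theorem isConnectedObj_of_unique (hE : P empty) (hincl : ∀ A : C, P ((FormalCoproduct.incl C).obj A))
    (hT : ∀ A : C, P (twoPoint A)) (X : P.FullSubcategory) [Unique X.obj.I] : IsConnectedObj X :=
  (isConnectedObj_incl hE (X.obj.obj default) (hincl _) (hT _)).of_iso
    (P.isoMk (isoInclOfUnique X.obj)).symm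

end CoproductCompletion

open CoproductCompletion

/-! ### `C^⊥`: connected objects and `C ⥲ (C^⊥)⁰` -/

/-- In `C^⊥`, an object is connected iff its index set is a singleton.
[cite: MochizukiFrdI2008, §0 p.16] -/
theorem isConnectedObj_iff_finiteCoproductCompletion (X : FiniteCoproductCompletion.{w} C) :
    IsConnectedObj X ↔ Nonempty X.obj.I ∧ Subsingleton X.obj.I := by
  constructor
  · intro hX
    exact ⟨nonempty_index_of_isConnectedObj hX,
      subsingleton_index_of_isConnectedObj (P := finiteFormalCoproducts.{w} C)
        (show Finite PEmpty.{w + 1} from inferInstance)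
        (fun Y p (hY : Finite Y.I) => show Finite {i // p i} from inferInstance)
        (fun Y Z (hY : Finite Y.I) (hZ : Finite Z.I) => show Finite (Y.I ⊕ Z.I) from inferInstance) hX⟩
  · rintro ⟨⟨i⟩, hs⟩
    haveI : Unique X.obj.I := uniqueOfSubsingleton i
    exact isConnectedObj_of_unique (P := finiteFormalCoproducts.{w} C)
      (show Finite PEmpty.{w + 1} from inferInstance)
      (fun A => show Finite PUnit.{w + 1} from inferInstance)
      (fun A => show Finite (PUnit.{w + 1} ⊕ PUnit.{w + 1}) from inferInstance) X

/-- In `C^⊤`, an object is connected iff its index set is a singleton.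
[cite: MochizukiFrdI2008, §0 p.16] -/
theorem isConnectedObj_iff_countableCoproductCompletion (X : CountableCoproductCompletion.{w} C) :
    IsConnectedObj X ↔ Nonempty X.obj.I ∧ Subsingleton X.obj.I := by
  constructor
  · intro hX
    exact ⟨nonempty_index_of_isConnectedObj hX,
      subsingleton_index_of_isConnectedObj (P := countableFormalCoproducts.{w} C)
        (show Countable PEmpty.{w + 1} from inferInstance)
        (fun Y p (hY : Countable Y.I) => show Countable {i // p i} from inferInstance)
        (fun Y Z (hY : Countable Y.I) (hZ : Countable Z.I) => show Countable (Y.I ⊕ Z.I) from inferInstance)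
        hX⟩
  · rintro ⟨⟨i⟩, hs⟩
    haveI : Unique X.obj.I := uniqueOfSubsingleton i
    exact isConnectedObj_of_unique (P := countableFormalCoproducts.{w} C)
      (show Countable PEmpty.{w + 1} from inferInstance)
      (fun A => show Countable PUnit.{w + 1} from inferInstance)
      (fun A => show Countable (PUnit.{w + 1} ⊕ PUnit.{w + 1}) from inferInstance) X

variable (C) in
/-- The functor `C → (C^⊥)⁰`, `A ↦ incl A` (FrdI §0 p. 16). [cite: MochizukiFrdI2008, §0 p.16] -/
def toConnectedPartFinite : C ⥤ ConnectedPart (FiniteCoproductCompletion.{w} C) :=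
  ObjectProperty.lift _ (toFiniteCoproductCompletion.{w} C) fun A =>
    isConnectedObj_toFiniteCoproductCompletion A

variable (C) in
/-- The functor `C → (C^⊤)⁰`, `A ↦ incl A` (FrdI §0 p. 16). [cite: MochizukiFrdI2008, §0 p.16] -/
def toConnectedPartCountable : C ⥤ ConnectedPart (CountableCoproductCompletion.{w} C) :=
  ObjectProperty.lift _ (toCountableCoproductCompletion.{w} C) fun A =>
    isConnectedObj_toCountableCoproductCompletion A

/-- **"`(C^⊥)⁰ ⥲ C`"** (FrdI §0 p. 16), in the direction `C → (C^⊥)⁰`: `A ↦ incl A` is an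
equivalence of categories. [cite: MochizukiFrdI2008, §0 p.16] -/
theorem toConnectedPartFinite_isEquivalence : (toConnectedPartFinite.{w} C).IsEquivalence := by
  haveI : (toFiniteCoproductCompletion.{w} C).Full :=
    inferInstanceAs ((finiteFormalCoproducts.{w} C).lift (FormalCoproduct.incl C) _).Full
  haveI : (toFiniteCoproductCompletion.{w} C).Faithful :=
    inferInstanceAs ((finiteFormalCoproducts.{w} C).lift (FormalCoproduct.incl C) _).Faithful
  haveI : (toConnectedPartFinite.{w} C).Full := inferInstanceAs (ObjectProperty.lift _ _ _).Full
  haveI : (toConnectedPartFinite.{w} C).Faithful := inferInstanceAs (ObjectProperty.lift _ _ _).Faithful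
  haveI : (toConnectedPartFinite.{w} C).EssSurj := by
    refine ⟨fun Y => ?_⟩
    obtain ⟨⟨i⟩, hs⟩ := (isConnectedObj_iff_finiteCoproductCompletion Y.obj).mp Y.property
    haveI : Unique Y.obj.obj.I := uniqueOfSubsingleton i
    let e : Y.obj.obj ≅ (FormalCoproduct.incl C).obj (Y.obj.obj.obj default) := isoInclOfUnique Y.obj.obj
    exact ⟨Y.obj.obj.obj default,
      ⟨(connectedObjects _).isoMk (((finiteFormalCoproducts.{w} C).isoMk e).symm :
        (toFiniteCoproductCompletion.{w} C).obj (Y.obj.obj.obj default) ≅ Y.obj)⟩⟩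
  exact {}

/-- **"`(C^⊤)⁰ ⥲ C`"** (FrdI §0 p. 16), in the direction `C → (C^⊤)⁰`: `A ↦ incl A` is an
equivalence of categories. [cite: MochizukiFrdI2008, §0 p.16] -/
theorem toConnectedPartCountable_isEquivalence : (toConnectedPartCountable.{w} C).IsEquivalence := by
  haveI : (toCountableCoproductCompletion.{w} C).Full :=
    inferInstanceAs ((countableFormalCoproducts.{w} C).lift (FormalCoproduct.incl C) _).Full
  haveI : (toCountableCoproductCompletion.{w} C).Faithful :=
    inferInstanceAs ((countableFormalCoproducts.{w} C).lift (FormalCoproduct.incl C) _).Faithful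
  haveI : (toConnectedPartCountable.{w} C).Full := inferInstanceAs (ObjectProperty.lift _ _ _).Full
  haveI : (toConnectedPartCountable.{w} C).Faithful :=
    inferInstanceAs (ObjectProperty.lift _ _ _).Faithful
  haveI : (toConnectedPartCountable.{w} C).EssSurj := by
    refine ⟨fun Y => ?_⟩
    obtain ⟨⟨i⟩, hs⟩ := (isConnectedObj_iff_countableCoproductCompletion Y.obj).mp Y.property
    haveI : Unique Y.obj.obj.I := uniqueOfSubsingleton i
    let e : Y.obj.obj ≅ (FormalCoproduct.incl C).obj (Y.obj.obj.obj default) := isoInclOfUnique Y.obj.obj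
    exact ⟨Y.obj.obj.obj default,
      ⟨(connectedObjects _).isoMk (((countableFormalCoproducts.{w} C).isoMk e).symm :
        (toCountableCoproductCompletion.{w} C).obj (Y.obj.obj.obj default) ≅ Y.obj)⟩⟩
  exact {}

end Literature.AlgebraicGeometry.Frobenioids
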